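import Mathlib
import HarnessLib
import HarnessLib.Audit
import Summits.HodgeConjecture.HodgeConjecture.Theses.KleimanBFSeeds
import Summits.HodgeConjecture.HodgeConjecture.Theses.DoublyPolarisedTransport
import Summits.HodgeConjecture.HodgeConjecture.Theorems.DoublyPolarisedSimilarAnchorsOfTwistedCube
import Summits.HodgeConjecture.HodgeConjecture.Theorems.KleimanBFSeedsWeilSimilarTrans
import Summits.HodgeConjecture.HodgeConjecture.Theorems.KleimanBFSeedsKleimanSemiregularAnchorReductions
import Summits.HodgeConjecture.HodgeConjecture.Theorems.Ring2AbelianAllWeilSimilarDiscriminant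
import Literature.AlgebraicGeometry.Motives.WeilSimilar
import Literature.AlgebraicGeometry.HodgeTheory.WeilClassesBFSheafSeedAt
import Literature.AlgebraicGeometry.HodgeTheory.ChernCharacterBettiTwistNormalised
import Literature.AlgebraicGeometry.HodgeTheory.SemiregularVariationalHodgeISemiregularCoherent

/-!
# Skeleton `Lines/chosen-anchor` for the REPAIRED crux `TwistNormalisedKleimanSemiregularAnchorR` (K2ᵀᴿ)

HONEST FRAMING: a crux PROOF SKELETON (cruxes-workfile class, BC3 shape), not a proof. Exactly THREE `sorry`s, inside
the three declared stubs `stub_good` (the load-bearing ∃-core of K2ᵀᴿ: one good anchor per non-split cell, the design ⟹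
COHERENT-seed upgrade holding there), `stub_rung_CMclass_d12` (T3 plan-only first-rung CANDIDATE, `d = 12`, the native secant discriminant — CAVEAT-II §5, officer READ #9 ×2) and `stub_rung_CMclass_d3` (second rung, `d = 3`); every other
declaration is sorry-free and uses tree theorems only. Nothing here proves K2ᵀᴿ, K2ᵀ (28148), the rung, `WeilSixfolds`
(rung H2), HC_AV, HC_CM or HC; typed ≠ proved.

PROVENANCE: route-repair pass `routerepair-KleimanBFSeeds-1` g0 (operator priority27 ∕ director-hodge req-181 (B2),
2026-08-31) — the registered line `Cruxes/TwistNormalisedKleimanSemiregularAnchor/Lines/chosen_anchor.lean` of K2ᵀ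
(stubs `stub_good` ∕ `stub_rung_CMclass_d3`) RE-TYPED for the W1 repair: the upgrade clause at a good anchor is
`HasWeilClassDesignAt C 3 P h w → HasBFCoherentSeedAt C P h w` — the seed is an `𝒪_P`-module `E₀` GIVEN WITH a strictly
perfect resolution `R` (`Modules.StrictlyPerfectResolution`), `(σ_q)_{q+1 ∈ I}` jointly injective on `Ext²(E₀,E₀)` read on
`R.P` in a window `[b, 0]` (`HomComplex.IsISemiregularC`), Chern data `chPerfect C P.X R.P` — VERBATIM the seed binders of
the REFEREED fact `BuchweitzFlenner2003_variationalHodge_ISemiregular_coherent` (BF 2003 Thm. 5.1, coherent generality).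
The vector-bundle seed of K2ᵀ embeds (`hasBFCoherentSeedAt_of_hasBFSheafSeedAt`: trivial resolution `E₀[0]`,
`HomComplex.isISemiregularC_single₀_iff` + `chPerfect_single`, both PROVED), so K2ᵀ ⟹ K2ᵀᴿ pointwise
(`twistNormalisedKleimanSemiregularAnchorR_of_anchor`) and every landed reduction of the K2ᵀ line survives.

CONTENTS. `HasBFCoherentSeedAt` (the repaired seed predicate at one anchor) · `MemberwiseAtR C d` (body of K2ᵀᴿ at one
`(C, d)`; `twistNormalisedKleimanSemiregularAnchorR_iff` is `Iff.rfl`) · `GoodAnchorInCellAtR` ∕ `GoodAnchorPerClassAtR` ∕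
`GoodAnchorPerDiscriminantClassR` (registered signature of `stub_good`) · `KleimanAnchorRungCMR d` (the rung; `d = 3` is
`stub_rung_CMclass_d3`) · PROVED: `memberwiseAtR_of_goodAnchorPerClassAtR` (pointwise Landherr, verbatim the K2ᵀ proof —
the upgrade clause is carried, never opened), `kleimanAnchorRungCMR_of_goodAnchorPerDiscriminantClassR`,
`rungR_of_twistNormalisedKleimanSemiregularAnchorR`, the K2ᵀ-edges `hasBFCoherentSeedAt_of_hasBFSheafSeedAt`,
`memberwiseAtR_of_memberwiseAt`-shaped `twistNormalisedKleimanSemiregularAnchorR_of_anchor`, and the composition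
`TwistNormalisedKleimanSemiregularAnchorR_of` (sorry-cone = `stub_good` only) concluding the crux BY NAME.

References: [BuchweitzFlenner2003 = arXiv:math/9912245] Def. 4.1, §5 (I-semiregular), Thm. 5.1 (coherent `ℰ_0`);
[vanGeemen1994HodgeAV] 4.14, Lemma 5.2, 5.3–5.4; [Landherr1936HermitianForms]; [Markman arXiv:2509.23403] §3 (reflexive
secant sheaves, p. 6–7), Lemma 11.3 ∕ Question 11.4 (p. 18); [arXiv:2603.20268] §1 (non-split Weil sixfolds open).
-/

set_option linter.dupNamespace false

noncomputable section

open CategoryTheory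
open Literature.AlgebraicGeometry Literature.AlgebraicGeometry.Modules
open Literature.AlgebraicGeometry.Motives
open Literature.AlgebraicGeometry.HodgeTheory
open Literature.AlgebraicGeometry.VanGeemen1994
open Summit.HodgeConjecture.HodgeConjecture.Ring2.AbelianAll

namespace Summit.HodgeConjecture.HodgeConjecture.Cruxes.TwistNormalisedKleimanSemiregularAnchorR.ChosenAnchor

/-! ### §0 The statements -/

/-- **The REPAIRED seed predicate — a Buchweitz–Flenner COHERENT seed at the anchor `(P, h, w)` for `C`** (W1): an index
set `I ∋ 3`, an `𝒪_P`-module `E₀` GIVEN WITH a strictly perfect resolution `R`, rationals `q`, `N ≠ 0`, `c`, such that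
`(σ_q)_{q+1 ∈ I}` is jointly injective on `Hom_{D(P)}(R.P, R.P[2]) = Ext²(E₀,E₀)` in some window `[b, 0]`
(`HomComplex.IsISemiregularC`, Mathlib's standard derived category), `ch₃(R.P) = q·h³ + N·w` and `chₚ(R.P) = cₚ·hᵖ`
(`p ∈ I ∖ {3}`) for the Chern character `chPerfect C P.X R.P`. VERBATIM the seed binders of the refereed fact
`BuchweitzFlenner2003_variationalHodge_ISemiregular_coherent`; on `P.X` itself (no model quantifier: the fact takes the
model isomorphism in its own binders). [cite: BuchweitzFlenner2003, Def. 4.1, §5 (I-semiregular) and Thm. 5.1] -/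
def HasBFCoherentSeedAt (C : ChernCharacterBetti) (P : AbelianVariety ℂ) (h : complexBetti P.X 2)
    (w : complexBetti P.X (2 * 3)) : Prop :=
  ∃ (I : Finset ℕ) (E₀ : P.X.left.Modules) (R : StrictlyPerfectResolution E₀) (q N : ℚ) (c : ℕ → ℚ),
    3 ∈ I ∧ N ≠ 0 ∧
    (∃ (b : ℤ) (_ : R.P.IsStrictlyGE b), letI := HasDerivedCategory.standard P.X.left.Modules;
      HomComplex.IsISemiregularC P.X R.P b 0 R.isBoundedVB.isFiniteLocallyFree {q' | q' + 1 ∈ I}) ∧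
    chPerfect C P.X R.P R.isBoundedVB.isFiniteLocallyFree 3 = ((q : ℚ) : ℂ) • cupPowTwo h 3 + ((N : ℚ) : ℂ) • w ∧
    ∀ p' ∈ I, p' ≠ 3 → chPerfect C P.X R.P R.isBoundedVB.isFiniteLocallyFree p' = ((c p' : ℚ) : ℂ) • cupPowTwo h p'

/-- **K2ᵀᴿ at one `(C, d)`** (member-wise body, VERBATIM the repaired route decl under its binders): every non-hyperbolic
`√−d` Weil sixfold member carrying a non-zero Hodge Weil class has a doubly-polarised anchor Weil-similar to it at which
class designs upgrade to COHERENT Buchweitz–Flenner seeds. [cite: BuchweitzFlenner2003, §5 Thm. 5.1] -/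
def MemberwiseAtR (C : ChernCharacterBetti) (d : ℕ) : Prop :=
  ∀ (A : AbelianVariety ℂ) (φ : A ⟶ A), A.dim = 2 * 3 → φ ≫ φ = -(d • 𝟙 A) →
    (∀ (e : ProjectiveEmbedding A.X) (a : complexBetti (projectiveSpace e.n ℂ) 2), IsRationalClass a → a ≠ 0 →
      ¬ IsHyperbolicWeilType A φ 3
        ((d : ℂ) • complexBetti.map e.ι 2 a + complexBetti.map φ.hom.hom.hom 2 (complexBetti.map e.ι 2 a))) →
    (∃ wA : complexBetti A.X (2 * 3), wA ∈ weilClassesOf A φ 3 d ∧ wA ≠ 0 ∧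
      IsOfHodgeType (2 * 3) A.X (2 * 3) 3 3 wA) →
    ∃ (eA : ProjectiveEmbedding A.X) (aA : complexBetti (projectiveSpace eA.n ℂ) 2) (P : AbelianVariety ℂ)
      (ψ₀ : P ⟶ P) (e e' : ProjectiveEmbedding P.X) (a : complexBetti (projectiveSpace e.n ℂ) 2)
      (a' : complexBetti (projectiveSpace e'.n ℂ) 2) (w : complexBetti P.X (2 * 3)),
      IsRationalClass aA ∧ aA ≠ 0 ∧ P.dim = 2 * 3 ∧ ψ₀ ≫ ψ₀ = -(d • 𝟙 P) ∧ IsRationalClass a ∧ a ≠ 0 ∧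
      IsRationalClass a' ∧ a' ≠ 0 ∧ w ∈ weilClassesOf P ψ₀ 3 d ∧ IsRationalClass w ∧ w ≠ 0 ∧
      IsOfHodgeType (2 * 3) P.X (2 * 3) 3 3 w ∧
      IsHyperbolicWeilType P ψ₀ 3 ((d : ℂ) • complexBetti.map e'.ι 2 a' + complexBetti.map ψ₀.hom.hom.hom 2 (complexBetti.map e'.ι 2 a')) ∧
      ¬ IsHyperbolicWeilType P ψ₀ 3 ((d : ℂ) • complexBetti.map e.ι 2 a + complexBetti.map ψ₀.hom.hom.hom 2 (complexBetti.map e.ι 2 a)) ∧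
      (HasWeilClassDesignAt C 3 P ((d : ℂ) • complexBetti.map e.ι 2 a + complexBetti.map ψ₀.hom.hom.hom 2 (complexBetti.map e.ι 2 a)) w → HasBFCoherentSeedAt C P ((d : ℂ) • complexBetti.map e.ι 2 a + complexBetti.map ψ₀.hom.hom.hom 2 (complexBetti.map e.ι 2 a)) w) ∧
      IsWeilSimilar 3 P ψ₀ ((d : ℂ) • complexBetti.map e.ι 2 a + complexBetti.map ψ₀.hom.hom.hom 2 (complexBetti.map e.ι 2 a)) A φ ((d : ℂ) • complexBetti.map eA.ι 2 aA + complexBetti.map φ.hom.hom.hom 2 (complexBetti.map eA.ι 2 aA))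

/-- Guard: the repaired route decl K2ᵀᴿ is LITERALLY `∀ C, twist-normalised → Kleiman → ∀ d > 0, MemberwiseAtR C d`
(`Iff.rfl`). [folklore] -/
theorem twistNormalisedKleimanSemiregularAnchorR_iff :
    Summit.HodgeConjecture.HodgeConjecture.Theses.KleimanBFSeeds.TwistNormalisedKleimanSemiregularAnchorR ↔
      ∀ C : ChernCharacterBetti, C.IsTwistNormalised → C.KleimanChernNormalForm → ∀ d : ℕ, 0 < d →
        MemberwiseAtR C d :=
  Iff.rfl

/-- **One good anchor in the cell `δ`** (for `C`, `d`), repaired upgrade clause: a `(3, d)` anchor with a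
non-degenerate discriminant witness of class `δ` at `h(e, a)`, hyperbolic at `h(e′, a′)`, `w` a non-zero rational `(3,3)`
Weil class, AT WHICH every class-level design upgrades to a COHERENT BF seed. [cite: vanGeemen1994HodgeAV, 4.14 and Lemma 5.2] -/
def GoodAnchorInCellAtR (C : ChernCharacterBetti) (d : ℕ) (δ : weilNormResidueGroup d) : Prop :=
  ∃ (P : AbelianVariety ℂ) (ψ₀ : P ⟶ P) (e e' : ProjectiveEmbedding P.X)
    (a : complexBetti (projectiveSpace e.n ℂ) 2) (a' : complexBetti (projectiveSpace e'.n ℂ) 2)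
    (w : complexBetti P.X (2 * 3)),
    P.dim = 2 * 3 ∧ ψ₀ ≫ ψ₀ = -(d • 𝟙 P) ∧ IsRationalClass a ∧ a ≠ 0 ∧ IsRationalClass a' ∧ a' ≠ 0 ∧
    w ∈ weilClassesOf P ψ₀ 3 d ∧ IsRationalClass w ∧ w ≠ 0 ∧ IsOfHodgeType (2 * 3) P.X (2 * 3) 3 3 w ∧
    IsHyperbolicWeilType P ψ₀ 3 ((d : ℂ) • complexBetti.map e'.ι 2 a' + complexBetti.map ψ₀.hom.hom.hom 2 (complexBetti.map e'.ι 2 a')) ∧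
    HasWeilDiscriminantNondeg P ψ₀ 3 d ((d : ℂ) • complexBetti.map e.ι 2 a + complexBetti.map ψ₀.hom.hom.hom 2 (complexBetti.map e.ι 2 a)) δ ∧
    (HasWeilClassDesignAt C 3 P ((d : ℂ) • complexBetti.map e.ι 2 a + complexBetti.map ψ₀.hom.hom.hom 2 (complexBetti.map e.ι 2 a)) w → HasBFCoherentSeedAt C P ((d : ℂ) • complexBetti.map e.ι 2 a + complexBetti.map ψ₀.hom.hom.hom 2 (complexBetti.map e.ι 2 a)) w)

/-- **One good anchor per non-split cell** (for `C`, `d`). [cite: vanGeemen1994HodgeAV, 5.3–5.4] [cite: Landherr1936HermitianForms] -/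
def GoodAnchorPerClassAtR (C : ChernCharacterBetti) (d : ℕ) : Prop :=
  ∀ δ : weilNormResidueGroup d, weilSign d δ = (-1) ^ 3 → δ ≠ QuotientGroup.mk ((-1 : ℚˣ) ^ 3) →
    GoodAnchorInCellAtR C d δ

/-- **Registered signature of `stub_good`** (the ∃-core of K2ᵀᴿ): for every twist-normalised Kleiman `C`, every `d ≥ 1`
and every non-split cell, one good anchor (repaired upgrade clause). [cite: BuchweitzFlenner2003, §5 Thm. 5.1]
[cite: vanGeemen1994HodgeAV, 5.3–5.4] -/
def GoodAnchorPerDiscriminantClassR : Prop :=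
  ∀ C : ChernCharacterBetti, C.IsTwistNormalised → C.KleimanChernNormalForm → ∀ d : ℕ, 0 < d →
    GoodAnchorPerClassAtR C d

/-- **THE RUNG `KleimanAnchorRungCMR d`**: K2ᵀᴿ RESTRICTED TO THE DISCRIMINANT `d` (members = the non-hyperbolic `√−d`
Weil sixfolds, each Weil-similar by X2 + Landherr to the CM anchor `(E₀³ × Ē₀³, h_b)`, `b ∉ Nm ℚ(√−d)ˣ`, of its cell).
`d = 3` is the first rung `stub_rung_CMclass_d3`. [cite: vanGeemen1994HodgeAV, 5.3–5.4] [cite: BuchweitzFlenner2003, §5 Thm. 5.1] -/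
def KleimanAnchorRungCMR (d : ℕ) : Prop :=
  ∀ C : ChernCharacterBetti, C.IsTwistNormalised → C.KleimanChernNormalForm → 0 < d → MemberwiseAtR C d

/-! ### §1 Pointwise Landherr: one good anchor per cell ⟹ the member-wise statement (PROVED; the clause is carried) -/

/-- **`GoodAnchorPerClassAtR C d → MemberwiseAtR C d`** (`0 < d`): verbatim the K2ᵀ proof
(`ChosenAnchor.memberwiseAt_of_goodAnchorPerClassAt`) — the member's own discriminant class `δ` has sign `(−1)³` and is
not split (else the member would be hyperbolic), the good anchor of class `δ` is not hyperbolic at `h(e,a)` and is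
Weil-similar to the member by Landherr; the upgrade clause is passed through unopened.
[cite: vanGeemen1994HodgeAV, 4.14, Lemma 5.2 (1)–(4), 5.3–5.4] [cite: Landherr1936HermitianForms] -/
theorem memberwiseAtR_of_goodAnchorPerClassAtR (C : ChernCharacterBetti) {d : ℕ} (hd : 0 < d)
    (hgood : GoodAnchorPerClassAtR C d) : MemberwiseAtR C d := by
  intro A φ hA hφ hns hwA
  obtain ⟨wA, hwA, hwA0, hwAH⟩ := hwA
  have n3 : (0 : ℕ) < 3 := by norm_num
  have hW' : IsWeilType A φ 3 d := isWeilType_of_weilClass_ne_zero n3 hd hA hφ hwA hwA0 hwAH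
  obtain ⟨eA, aA, haA, haA0, -⟩ := exists_weightedSegreEmbedding_self_prod A
  obtain ⟨δ, hδA, hsign⟩ := exists_hasWeilDiscriminantNondeg_weilSign hW' eA haA haA0
  have hne : δ ≠ QuotientGroup.mk ((-1 : ℚˣ) ^ 3) := by
    rintro rfl
    obtain ⟨-, e, a, ha, ha0, hh⟩ :=
      Literature.AlgebraicGeometry.VanGeemen1994.IsWeilType.isSplitWeilType_of_hasWeilDiscriminantNondeg_split
        hW' eA haA haA0 hδA
    exact hns e a ha ha0 hh
  obtain ⟨P, ψ₀, e, e', a, a', w, hP, hψ, ha, ha0, ha', ha'0, hwW, hwrat, hw0, hwH, hhyp, hN, hup⟩ :=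
    hgood δ hsign hne
  have hWP : IsWeilType P ψ₀ 3 d := isWeilType_of_weilClass_ne_zero n3 hd hP hψ hwW hw0 hwH
  have hnot := not_isHyperbolicWeilType_of_hasWeilDiscriminantNondeg_ne n3 hP hd hψ e ha ha0 hN hne
  have hsim := isWeilSimilar_of_hasWeilDiscriminantNondeg hWP hW' e ha ha0 eA haA haA0 hN hδA
  exact ⟨eA, aA, P, ψ₀, e, e', a, a', w, haA, haA0, hP, hψ, ha, ha0, ha', ha'0, hwW, hwrat, hw0, hwH, hhyp,
    hnot, hup, hsim⟩

/-- The registered stub statement gives every rung. [cite: vanGeemen1994HodgeAV, 5.3–5.4] -/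
theorem kleimanAnchorRungCMR_of_goodAnchorPerDiscriminantClassR (h : GoodAnchorPerDiscriminantClassR) (d : ℕ) :
    KleimanAnchorRungCMR d :=
  fun C hT hK hd => memberwiseAtR_of_goodAnchorPerClassAtR C hd (h C hT hK d hd)

/-- The crux K2ᵀᴿ gives the rung (restriction to `d`). [cite: BuchweitzFlenner2003, §5 Thm. 5.1] -/
theorem rungR_of_twistNormalisedKleimanSemiregularAnchorR
    (k2TR : Summit.HodgeConjecture.HodgeConjecture.Theses.KleimanBFSeeds.TwistNormalisedKleimanSemiregularAnchorR)
    (d : ℕ) : KleimanAnchorRungCMR d :=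
  fun C hT hK hd => k2TR C hT hK d hd

/-! ### §2 The K2ᵀ edges (PROVED): vector-bundle seeds are coherent seeds -/

/-- **`HasBFSheafSeedAt C 3 P h w → HasBFCoherentSeedAt C P h w`**: instantiate the ∀-model seed at the model
`Iso.refl P.X` and take the trivial resolution `E₀[0]` (`StrictlyPerfectResolution.ofFiniteLocallyFree`, window `[0,0]`):
complex-level `I`-semiregularity of `E₀[0]` is the module-level one (`HomComplex.isISemiregularC_single₀_iff`) and
`ch_p(E₀[0]) = ch_p(E₀)` (`chPerfect_single`) — exactly as `BuchweitzFlenner2003_variationalHodge_ISemiregular_model_of_coherent`.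
[cite: BuchweitzFlenner2003, §5 (I-semiregular) and §4 (arXiv p. 20 L5–8: a module in degree 0 is perfect)] -/
theorem hasBFCoherentSeedAt_of_hasBFSheafSeedAt (C : ChernCharacterBetti) (P : AbelianVariety ℂ)
    (h : complexBetti P.X 2) (w : complexBetti P.X (2 * 3)) (hS : HasBFSheafSeedAt C 3 P h w) :
    HasBFCoherentSeedAt C P h w := by
  obtain ⟨I, E₀, hE₀, q, N, c, h3I, hN, hsr, hch3, hchp⟩ := hS P.X (Iso.refl P.X)
  letI := HasDerivedCategory.standard P.X.left.Modules
  let R : StrictlyPerfectResolution E₀ := StrictlyPerfectResolution.ofFiniteLocallyFree hE₀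
  have hK : ∀ p, IsFiniteLocallyFree ((HomComplex.single₀ P.X.left E₀).X p) := R.isBoundedVB.isFiniteLocallyFree
  have hch : ∀ p, chPerfect C P.X R.P R.isBoundedVB.isFiniteLocallyFree p = C.ch P.X E₀ p := fun p =>
    chPerfect_single C P.X E₀ hE₀ hK p
  have hid : ∀ (k : ℕ) (x : complexBetti P.X k), complexBetti.map (Iso.refl P.X).hom k x = x := fun k x => by
    rw [Iso.refl_hom, complexBetti.map_id]; rfl
  refine ⟨I, E₀, R, q, N, c, h3I, hN,
    ⟨0, inferInstanceAs ((HomComplex.single₀ P.X.left E₀).IsStrictlyGE 0),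
      (HomComplex.isISemiregularC_single₀_iff P.X E₀ hE₀ hK {q' | q' + 1 ∈ I}).2 hsr⟩, ?_, fun p' hp' hp'3 => ?_⟩
  · rw [hch, ← hid _ (C.ch P.X E₀ 3), hch3]
  · rw [hch, ← hid _ (C.ch P.X E₀ p'), hchp p' hp' hp'3]

/-- **K2ᵀ ⟹ K2ᵀᴿ** (the repaired crux is a WEAKENING of the filed one; every landed reduction of the K2ᵀ line survives).
[cite: BuchweitzFlenner2003, §5 Thm. 5.1] -/
theorem twistNormalisedKleimanSemiregularAnchorR_of_anchor
    (k2T : Summit.HodgeConjecture.HodgeConjecture.Theses.KleimanBFSeeds.TwistNormalisedKleimanSemiregularAnchor) :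
    Summit.HodgeConjecture.HodgeConjecture.Theses.KleimanBFSeeds.TwistNormalisedKleimanSemiregularAnchorR := by
  intro C hT hCK d hd A φ hA hφ hnh hwA
  obtain ⟨eA, aA, P, ψ₀, e, e', a, a', w, haA, haA0, hP, hψ, ha, ha0, ha', ha'0, hwW, hwrat, hw0, hwH, hhyp,
    hnhyp, himp, hsim⟩ := k2T C hT hCK d hd A φ hA hφ hnh hwA
  exact ⟨eA, aA, P, ψ₀, e, e', a, a', w, haA, haA0, hP, hψ, ha, ha0, ha', ha'0, hwW, hwrat, hw0, hwH, hhyp,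
    hnhyp, fun hdesign => hasBFCoherentSeedAt_of_hasBFSheafSeedAt C P _ w (himp hdesign), hsim⟩

/-! ### §3 The stubs -/

/-- **STUB `stub_good`** (LOAD-BEARING; registered signature `GoodAnchorPerDiscriminantClassR`): for every twist-normalised
Kleiman `C`, every `d ≥ 1` and every non-split `√−d` cell, ONE doubly-polarised `(3, d)` anchor at which class designs
upgrade to COHERENT BF seeds. Why plausibly true: anchors with divisor-generated Hodge ring exist in every cell (X2, p602146)
and the repaired clause now admits the objects semiregular Weil seeds are made of in print — REFLEXIVE ∕ torsion-free
sheaves and perfect complexes (Markman's secant sheaves `𝓔 ≅ 𝓗om(𝒢₁, 𝒪)`, arXiv:2509.23403 p. 6–7; BF Def. 4.1 is for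
perfect complexes), not only vector bundles. Why it might fail: every C-evaluable coherent realisation at every anchor of
some non-split cell has `σ_I` non-injective on `Ext²(E₀,E₀)` (targets `h^{2,4} = 225` ∕ `Σ = 495`); the H2-census negatives at
E-power anchors (sums ∕ box products never semiregular in the Weil direction) persist for complexes built additively. Size XL.
[cite: BuchweitzFlenner2003, Def. 4.1 and §5 Thm. 5.1] [cite: vanGeemen1994HodgeAV, 5.3–5.4]
[cite: Markman2025SurveySecant, §3 and Lemma 11.3] -/
theorem stub_good : GoodAnchorPerDiscriminantClassR := by
  sorry

/-- **STUB `stub_rung_CMclass_d12`** (T3 PLAN-ONLY FIRST-RUNG CANDIDATE, BC5, registered signature `KleimanAnchorRungCMR 12`): K2ᵀᴿ on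
the d = 12 members — the NATIVE discriminant of Markman's secant anchors (`η(K) ∩ End = ℤ[2√−3]` on every secant member;
CAVEAT-II-NOTE-g17 §5, officer ×2 READ #9 hsem l.13544); the d = 3 rung below stays as the second rung. -/
theorem stub_rung_CMclass_d12 : KleimanAnchorRungCMR 12 := by
  sorry

/-- **STUB `stub_rung_CMclass_d3`** (T3 PLAN-ONLY FIRST RUNG, BC5; registered signature `KleimanAnchorRungCMR 3`): K2ᵀᴿ for
`d = 3` — every non-hyperbolic `ℚ(√−3)` Weil sixfold member (each Weil-similar to the CM anchor `(E_ω³ × Ē_ω³, h_b)`,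
`b ∉ Nm ℚ(ω)ˣ`, of its cell) has a doubly-polarised anchor with the design ⟹ coherent-seed upgrade. Implied by the crux
(`rungR_of_twistNormalisedKleimanSemiregularAnchorR · 3`) and by `stub_good`
(`kleimanAnchorRungCMR_of_goodAnchorPerDiscriminantClassR · 3`); its own stub because it is the route's first RUNG.
TECHNIQUE: ONE written object at the CM anchor `E_ω³ × Ē_ω³` (or a twisted square `T × T`, `φ_T² = −3`) — a torsion-free ∕
reflexive sheaf or a two-term complex of Serre-twist sums (C-evaluable for every twist-normalised `C` by
`IsTwistNormalised.exists_ch_serreTwist_one_eq_smul_map` + additivity of `chPerfect`), `I ∋ 3`, with `(σ_q)_{q+1∈I}`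
injective on `Ext²` — the instrument row of the K2ᵀ card (rank `σ` on `Ext²(E,E)`; `dim Ext²` vs `225`∕`495`; rank `ev_E`,
Markman arXiv:2509.23403 Lemma 11.3 p. 18) now read on a RESOLUTION. WHY OUTSIDE S's KNOWN REGIME: algebraicity of Weil
classes on non-split `ℚ(√−3)` sixfold cells is open in print (Schoen 1998 addendum = split `ℚ(√−3)`; Markman = hyperbolic
cells; arXiv:2603.20268 §1). Size L–XL. [cite: BuchweitzFlenner2003, §5 Thm. 5.1] [cite: vanGeemen1994HodgeAV, 5.3–5.4]
[cite: Markman2025SurveySecant, Lemma 11.3] -/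
theorem stub_rung_CMclass_d3 : KleimanAnchorRungCMR 3 := by
  sorry

/-! ### §4 Composition: the stub gives the crux BY NAME -/

/-- **Composition** (kernel-checked; `sorry`-cone = `stub_good` only): `stub_good` gives the repaired crux
`TwistNormalisedKleimanSemiregularAnchorR` BY NAME, by pointwise Landherr (§1). The rung stub is NOT in this cone.
[cite: vanGeemen1994HodgeAV, 4.14, Lemma 5.2, 5.3–5.4] [cite: Landherr1936HermitianForms] -/
theorem TwistNormalisedKleimanSemiregularAnchorR_of :
    Summit.HodgeConjecture.HodgeConjecture.Theses.KleimanBFSeeds.TwistNormalisedKleimanSemiregularAnchorR := by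
  have hgood : GoodAnchorPerDiscriminantClassR := stub_good
  intro C hT hK d hd
  exact memberwiseAtR_of_goodAnchorPerClassAtR C hd (hgood C hT hK d hd)

end Summit.HodgeConjecture.HodgeConjecture.Cruxes.TwistNormalisedKleimanSemiregularAnchorR.ChosenAnchor

end
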